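import Summits.NavierStokesRegularity.FluidComputer.PalasekTowerGermHost

/-!
# The germ host, IV-a: the PUSHED time profiles and the pushed line anchor under the WEAK first-order test

Cell `ns-blowup`, seat `ns-blowup-ecbridge-4` (g3); GROUP C «BRIDGE SUPPORT» of the route
`PalasekTowerBreakdown` (crux `EpisodeBaseG`, item stmt-NavierStokesRegularity-19179). Companion of
ecbridge-3's germ series `PalasekTowerMatchedGerm` / `…MatchedGermEnergy` / `…GermHostAnchor` /
`…GermHostForce` / `…BoxSchedule` / `…GermHost` (reused UNCHANGED); consumed by
`PalasekTowerGermHostPushed.lean` (the pushed germ host under the weak slot `LevelZeroDataWeak`).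
LABEL: E–C typing (KERNEL calculus: two time profiles and one compactness lemma). WHAT THIS IS NOT:
not Navier–Stokes evidence — no flow, stage or schedule is built here.

## Why a pushed germ (refuter4 K-ROW K56 (C); this seat's anchor repair, STATUS 2026-08-26)

`LevelZeroData` (GermHost, III) admits a named profile `U` only under the STRICT first-order test
`⟪U, V⟫ > 0` on the argmax of `‖U‖` (`V = P(ΔU − (U·∇)U)`), because its germ is MATCHED (`f(τ₀) = 0`,
`∂ₜu(τ₀) = V`) and arrives with `α ≡ 1` on `[1/2, 1]`: the speed maximum must rise BY ITSELF through
`Y₀` at `τ₀`. Every SMALL-DATA profile (scale-invariant size `≪ ν`) fails the strict test — at a tiny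
blob's argmax the free NS acceleration is viscous and points inwards, and for the flat, even blobs of
this seat's negative lane it VANISHES (`V(x₀) = 0`). The register, however, lets the PUSH pay for the
rise: with `α(t) = 1 − κ(1 − t)` near `τ₀ = 1` (`κ = c₄/2`) the germ `α • (U + σ • V)` reaches `U` with
`∂ₜu(τ₀) = κU + V`, residual `κ U` at `τ₀` (`‖·‖ ≤ c₄Y₀/2`, admissible on the window), and the GLOBAL
ANCHOR needs only the WEAK test `⟪U, V⟫ ≥ 0` on the argmax: `‖u‖² = (1 − κs)²(‖U‖² + 2σ⟪U,V⟫ + σ²‖V‖²)`,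
`s = 1 − t`, `σ ∈ [−s, 0]`, is `< Y₀²` near the argmax because the factor loses `κ s Y₀²` while the
segment gains at most `κ s Y₀²/2 + s²M²`, and away from it by the slack of `‖U‖ < Y₀`.

* §1 `αpush κ = αhost · (1 − κ(1 − ·))`, `βpush κ σ₀ = αpush κ · σline σ₀` and their calculus;
* §2 `exists_pushed_line_anchor` (weak test ⇒ `(1 − κs)‖U + σV‖ < Y` for `σ ∈ [−s, 0]`, `s ≤ s₀`),
  `norm_germ_pushed_lt` / `_le` (the global anchor of the pushed germ with line width `σ₀ = s₀`).

References: S. Palasek, arXiv:2605.13827 §3.3 [cite: Palasek2026ElementaryModel, §3.3]; A. J. Majda,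
A. L. Bertozzi, *Vorticity and Incompressible Flow* (CUP 2002), §1.8 Prop. 1.16
[cite: MajdaBertozziCUP2002, §1.8 Prop. 1.16].
-/

noncomputable section

namespace Summit.NavierStokesRegularity.FluidComputer.PalasekTowerClayBridge.Germ

open Set Function Filter Topology InnerProductSpace Metric MeasureTheory
open scoped Topology ContDiff RealInnerProductSpace ENNReal

open Literature.Analysis.FluidPDE

/-! ## §1 The pushed time profiles -/

/-- **The pushed amplitude** `αpush κ t = αhost t · (1 − κ (1 − t))`: `0` before `0`, equal to
`1 − κ(1 − t)` on `[1/2, ∞)`, value `1` and slope `κ` at `t = 1`. [folklore] -/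
def αpush (κ t : ℝ) : ℝ := αhost t * (1 - κ * (1 - t))

/-- **The pushed acceleration coefficient** `βpush κ σ₀ = αpush κ · σline σ₀`. [folklore] -/
def βpush (κ σ₀ t : ℝ) : ℝ := αpush κ t * σline σ₀ t

section Profiles

variable {κ σ₀ : ℝ}

/-- `αpush` is smooth. [folklore] -/
theorem contDiff_αpush (κ : ℝ) : ContDiff ℝ ∞ (αpush κ) :=
  contDiff_αhost.mul (contDiff_const.sub (contDiff_const.mul (contDiff_const.sub contDiff_id)))

/-- `αpush = 0` on `(−∞, 0]`. [folklore] -/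
theorem αpush_of_nonpos {t : ℝ} (ht : t ≤ 0) : αpush κ t = 0 := by
  rw [αpush, αhost_of_nonpos ht, zero_mul]

/-- On `[1/2, ∞)` the pushed amplitude is the affine function `1 − κ(1 − t)`. [folklore] -/
theorem αpush_of_half_le {t : ℝ} (ht : 1 / 2 ≤ t) : αpush κ t = 1 - κ * (1 - t) := by
  rw [αpush, αhost_of_half_le ht, one_mul]

/-- `αpush 1 = 1`. [folklore] -/
theorem αpush_one (κ : ℝ) : αpush κ 1 = 1 := by
  rw [αpush_of_half_le (by norm_num)]; ring

/-- `αpush' (1) = κ` — the PUSH. [folklore] -/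
theorem deriv_αpush_one (κ : ℝ) : deriv (αpush κ) 1 = κ := by
  have hev : αpush κ =ᶠ[𝓝 1] fun t => 1 - κ * (1 - t) := by
    filter_upwards [Ici_mem_nhds (show (1 : ℝ) / 2 < 1 by norm_num)] with t ht
    exact αpush_of_half_le ht
  rw [hev.deriv_eq]
  have h1 : HasDerivAt (fun t : ℝ => 1 - κ * (1 - t)) (-(κ * -1)) 1 :=
    (((hasDerivAt_id (1 : ℝ)).const_sub 1).const_mul κ).const_sub 1
  have h2 : -(κ * -1) = κ := by ring
  rw [h2] at h1
  exact h1.deriv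

/-- For `0 ≤ κ ≤ 1` and `0 ≤ t ≤ 1` the affine factor lies in `[0, 1]`. [folklore] -/
private theorem factor_mem (hκ0 : 0 ≤ κ) (hκ1 : κ ≤ 1) {t : ℝ} (ht0 : 0 ≤ t) (ht1 : t ≤ 1) :
    0 ≤ 1 - κ * (1 - t) ∧ 1 - κ * (1 - t) ≤ 1 := by
  constructor <;> nlinarith

/-- `0 ≤ αpush κ t` for `t ≤ 1` (`0 ≤ κ ≤ 1`). [folklore] -/
theorem αpush_nonneg (hκ0 : 0 ≤ κ) (hκ1 : κ ≤ 1) {t : ℝ} (ht : t ≤ 1) : 0 ≤ αpush κ t := by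
  rcases le_or_gt t 0 with h | h
  · rw [αpush_of_nonpos h]
  · exact mul_nonneg (αhost_nonneg t) (factor_mem hκ0 hκ1 h.le ht).1

/-- `αpush κ t ≤ 1 − κ(1 − t)` for `0 ≤ t ≤ 1` (`0 ≤ κ ≤ 1`). [folklore] -/
theorem αpush_le_factor (hκ0 : 0 ≤ κ) (hκ1 : κ ≤ 1) {t : ℝ} (ht0 : 0 ≤ t) (ht1 : t ≤ 1) :
    αpush κ t ≤ 1 - κ * (1 - t) := by
  rw [αpush]
  have h := factor_mem hκ0 hκ1 ht0 ht1
  calc αhost t * (1 - κ * (1 - t)) ≤ 1 * (1 - κ * (1 - t)) :=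
        mul_le_mul_of_nonneg_right (αhost_le_one t) h.1
    _ = 1 - κ * (1 - t) := one_mul _

/-- `αpush κ t ≤ 1` for `t ≤ 1` (`0 ≤ κ ≤ 1`). [folklore] -/
theorem αpush_le_one (hκ0 : 0 ≤ κ) (hκ1 : κ ≤ 1) {t : ℝ} (ht : t ≤ 1) : αpush κ t ≤ 1 := by
  rcases le_or_gt t 0 with h | h
  · rw [αpush_of_nonpos h]; exact zero_le_one
  · exact (αpush_le_factor hκ0 hκ1 h.le ht).trans (factor_mem hκ0 hκ1 h.le ht).2

/-- `|αpush κ t| ≤ 2` on `[0, 2]` for `0 ≤ κ ≤ 1` (a crude bound for the energy on the slab). [folklore] -/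
theorem abs_αpush_le (hκ0 : 0 ≤ κ) (hκ1 : κ ≤ 1) {t : ℝ} (ht : t ≤ 1) : |αpush κ t| ≤ 1 := by
  rw [abs_of_nonneg (αpush_nonneg hκ0 hκ1 ht)]
  exact αpush_le_one hκ0 hκ1 ht

/-- `βpush` is smooth. [folklore] -/
theorem contDiff_βpush (κ σ₀ : ℝ) : ContDiff ℝ ∞ (βpush κ σ₀) :=
  (contDiff_αpush κ).mul (contDiff_σline σ₀)

/-- `βpush = 0` on `(−∞, 0]`. [folklore] -/
theorem βpush_of_nonpos {t : ℝ} (ht : t ≤ 0) : βpush κ σ₀ t = 0 := by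
  rw [βpush, αpush_of_nonpos ht, zero_mul]

/-- `βpush 1 = 0`. [folklore] -/
theorem βpush_one (κ σ₀ : ℝ) : βpush κ σ₀ 1 = 0 := by
  rw [βpush, σline_one, mul_zero]

/-- `βpush' (1) = 1`. [folklore] -/
theorem deriv_βpush_one (κ : ℝ) (hσ₀ : σ₀ ≠ 0) : deriv (βpush κ σ₀) 1 = 1 := by
  have hα : HasDerivAt (αpush κ) κ 1 := by
    have := ((contDiff_αpush κ).differentiable (by simp) 1).hasDerivAt
    rwa [deriv_αpush_one] at this
  have hσ : HasDerivAt (σline σ₀) 1 1 := by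
    have := hasDerivAt_σline hσ₀ 1
    rwa [show Real.exp ((1 - 1) / σ₀) = 1 by simp] at this
  have h := hα.mul hσ
  rw [σline_one, mul_zero, αpush_one, one_mul, zero_add] at h
  exact h.deriv

/-- `−(1 − t) ≤ σline σ₀ t` (`σ₀ > 0`): `σ₀ (e^{(t−1)/σ₀} − 1) ≥ σ₀ · (t − 1)/σ₀`. [folklore] -/
theorem sub_le_σline (hσ₀ : 0 < σ₀) (t : ℝ) : -(1 - t) ≤ σline σ₀ t := by
  rw [σline]
  have h := Real.add_one_le_exp ((t - 1) / σ₀)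
  have h2 : σ₀ * ((t - 1) / σ₀) = t - 1 := by field_simp
  nlinarith

/-- `|βpush κ σ₀ t| ≤ σ₀` for `t ≤ 1` (`0 ≤ κ ≤ 1`, `σ₀ > 0`). [folklore] -/
theorem abs_βpush_le (hκ0 : 0 ≤ κ) (hκ1 : κ ≤ 1) (hσ₀ : 0 < σ₀) {t : ℝ} (ht : t ≤ 1) :
    |βpush κ σ₀ t| ≤ σ₀ := by
  rw [βpush, abs_mul]
  calc |αpush κ t| * |σline σ₀ t| ≤ 1 * σ₀ :=
        mul_le_mul (abs_αpush_le hκ0 hκ1 ht) (abs_σline_le hσ₀ ht) (abs_nonneg _) zero_le_one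
    _ = σ₀ := one_mul _

/-- **The pushed germ runs along the line**: `germ t = αpush κ t • (U + σline σ₀ t • V)`. [folklore] -/
theorem germ_eq_smul_line_pushed (ν : ℝ) (U : EuclideanSpace ℝ (Fin 3) → EuclideanSpace ℝ (Fin 3))
    (κ σ₀ t : ℝ) (x : EuclideanSpace ℝ (Fin 3)) :
    germ ν U (αpush κ) (βpush κ σ₀) t x = αpush κ t • (U x + σline σ₀ t • accel ν U x) := by
  rw [germ, βpush, smul_add, smul_smul]

/-- The pushed germ starts from rest. [folklore] -/
theorem germ_pushed_zero (ν : ℝ) (U : EuclideanSpace ℝ (Fin 3) → EuclideanSpace ℝ (Fin 3)) (κ σ₀ : ℝ) :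
    germ ν U (αpush κ) (βpush κ σ₀) 0 = 0 :=
  germ_zero (αpush_of_nonpos le_rfl) (βpush_of_nonpos le_rfl)

/-- The pushed germ passes through the profile at `t = 1`. [folklore] -/
theorem germ_pushed_one (ν : ℝ) (U : EuclideanSpace ℝ (Fin 3) → EuclideanSpace ℝ (Fin 3)) (κ σ₀ : ℝ) :
    germ ν U (αpush κ) (βpush κ σ₀) 1 = U := by
  funext x
  rw [germ, αpush_one, βpush_one, one_smul, zero_smul, add_zero]

end Profiles

/-! ## §2 The pushed line anchor from the WEAK first-order test -/

section Anchor

variable {ν : ℝ} {U : EuclideanSpace ℝ (Fin 3) → EuclideanSpace ℝ (Fin 3)}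

/-- **THE PUSHED LINE ANCHOR FROM THE WEAK TEST.** Let `U` be smooth with compact support, `‖U‖ ≤ Y`
everywhere (`Y > 0`), `κ > 0`, and suppose `⟪U(x), V(x)⟫ ≥ 0` wherever `‖U(x)‖ = Y` (`V = P(νΔU − (U·∇)U)`).
Then there is `s₀ ∈ (0, 1/2]` with `κ s₀ ≤ 1` such that for every `s ∈ (0, s₀]`, every `σ ∈ [−s, 0]` and
every `x`: `(1 − κ s) ‖U(x) + σ V(x)‖ < Y`. Proof: `V` is bounded by `M`; on the open set
`{⟪U,V⟫ > −κY²/4}` one has `‖U + σV‖² ≤ Y² + κ s Y²/2 + s²M²` and the factor `(1 − κs)² ≤ 1 − κs` wins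
for `s M² < κY²/2`; off it, the compact support carries `‖U‖ ≤ Y − δ` and `‖U + σV‖ ≤ Y − δ + sM`.
[cite: MajdaBertozziCUP2002, §1.8 Prop. 1.16] -/
theorem exists_pushed_line_anchor (hU : ContDiff ℝ ∞ U) (hUc : HasCompactSupport U) {Y κ : ℝ}
    (hY : 0 < Y) (hκ : 0 < κ) (hle : ∀ x, ‖U x‖ ≤ Y)
    (htest : ∀ x, ‖U x‖ = Y → 0 ≤ ⟪U x, accel ν U x⟫) :
    ∃ s₀ : ℝ, 0 < s₀ ∧ s₀ ≤ 1 / 2 ∧ κ * s₀ ≤ 1 ∧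
      ∀ s : ℝ, 0 < s → s ≤ s₀ → ∀ σ : ℝ, -s ≤ σ → σ ≤ 0 →
        ∀ x, (1 - κ * s) * ‖U x + σ • accel ν U x‖ < Y := by
  set V := accel ν U with hV
  set g : EuclideanSpace ℝ (Fin 3) → ℝ := fun x => ⟪U x, V x⟫ with hg
  have hUcont : Continuous U := hU.continuous
  have hVcont : Continuous V := (contDiff_accel hU hUc ν).continuous
  have hgc : Continuous g := hUcont.inner hVcont
  have hnc : Continuous fun x => ‖U x‖ := hUcont.norm
  obtain ⟨M, hM0, hM⟩ := exists_norm_accel_le hU hUc ν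
  -- the compact support, and its part where the test function is `≤ −κY²/4`
  set K := tsupport U with hK
  have hKc : IsCompact K := hUc
  set K₁ := K ∩ {x | g x ≤ -(κ * Y ^ 2 / 4)} with hK₁
  have hK₁c : IsCompact K₁ := hKc.inter_right (isClosed_le hgc continuous_const)
  have hlt₁ : ∀ x ∈ K₁, -Y < -‖U x‖ := by
    intro x hx
    have hne : ‖U x‖ ≠ Y := by
      intro h
      have h1 := htest x h
      have h2 : g x ≤ -(κ * Y ^ 2 / 4) := hx.2
      have h3 : 0 < κ * Y ^ 2 / 4 := by positivity
      simp only [hg] at h2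
      linarith
    have := lt_of_le_of_ne (hle x) hne
    linarith
  obtain ⟨a₁, ha₁, ha₁'⟩ := hK₁c.exists_forall_le' (f := fun x => -‖U x‖) hnc.neg.continuousOn hlt₁
  set δ := min (Y + a₁) Y with hδ
  have hδ0 : 0 < δ := lt_min (by linarith) hY
  have hδY : δ ≤ Y := min_le_right _ _
  have hK₁U : ∀ x ∈ K₁, ‖U x‖ ≤ Y - δ := by
    intro x hx
    have := ha₁' x hx
    have : δ ≤ Y + a₁ := min_le_left _ _
    linarith
  -- off `K₁`: either off the support (`U = 0`) or the test function is `> −κY²/4`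
  have hsplit : ∀ x, x ∉ K₁ → ‖U x‖ ≤ Y - δ ∨ -(κ * Y ^ 2 / 4) < g x := by
    intro x hx
    by_cases hxK : x ∈ K
    · right
      by_contra h
      exact hx ⟨hxK, not_lt.1 h⟩
    · left
      have : U x = 0 := image_eq_zero_of_notMem_tsupport hxK
      rw [this, norm_zero]
      linarith
  -- the width
  set s₀ := min (1 / 2) (min (1 / (2 * κ)) (min (κ * Y ^ 2 / (4 * (M ^ 2 + 1))) (δ / (2 * (M + 1)))))
    with hs₀
  have hs₀0 : 0 < s₀ := lt_min (by norm_num) (lt_min (by positivity) (lt_min (by positivity) (by positivity)))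
  have hs₀half : s₀ ≤ 1 / 2 := min_le_left _ _
  have hs₀κ : s₀ ≤ 1 / (2 * κ) := (min_le_right _ _).trans (min_le_left _ _)
  have hs₀near : s₀ ≤ κ * Y ^ 2 / (4 * (M ^ 2 + 1)) :=
    (min_le_right _ _).trans ((min_le_right _ _).trans (min_le_left _ _))
  have hs₀far : s₀ ≤ δ / (2 * (M + 1)) :=
    (min_le_right _ _).trans ((min_le_right _ _).trans (min_le_right _ _))
  have hκs₀ : κ * s₀ ≤ 1 := by
    have h1 : κ * s₀ ≤ κ * (1 / (2 * κ)) := mul_le_mul_of_nonneg_left hs₀κ hκ.le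
    have h2 : κ * (1 / (2 * κ)) = 1 / 2 := by field_simp
    linarith
  refine ⟨s₀, hs₀0, hs₀half, hκs₀, fun s hs0 hss σ hσl hσu x => ?_⟩
  have hκs : κ * s ≤ 1 := (mul_le_mul_of_nonneg_left hss hκ.le).trans hκs₀
  have hfac0 : 0 ≤ 1 - κ * s := by linarith
  have hfac1 : 1 - κ * s ≤ 1 := by nlinarith
  have hVx : ‖V x‖ ≤ M := hM x
  have hσabs : |σ| ≤ s := by rw [abs_le]; exact ⟨hσl, by linarith⟩
  -- the far estimate, used in two cases
  have hfar : ‖U x‖ ≤ Y - δ → (1 - κ * s) * ‖U x + σ • V x‖ < Y := by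
    intro hUx
    have hsM : s * (2 * (M + 1)) ≤ δ := by
      have := hss.trans hs₀far
      rwa [le_div_iff₀ (by positivity)] at this
    calc (1 - κ * s) * ‖U x + σ • V x‖ ≤ 1 * ‖U x + σ • V x‖ :=
          mul_le_mul_of_nonneg_right hfac1 (norm_nonneg _)
      _ ≤ ‖U x‖ + ‖σ • V x‖ := by rw [one_mul]; exact norm_add_le _ _
      _ = ‖U x‖ + |σ| * ‖V x‖ := by rw [norm_smul, Real.norm_eq_abs]
      _ ≤ (Y - δ) + s * M := add_le_add hUx (mul_le_mul hσabs hVx (norm_nonneg _) hs0.le)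
      _ < Y := by nlinarith
  by_cases hx1 : x ∈ K₁
  · exact hfar (hK₁U x hx1)
  rcases hsplit x hx1 with hUx | hgx
  · exact hfar hUx
  -- near the maximum: the factor wins
  have hsq : ‖U x + σ • V x‖ ^ 2 ≤ Y ^ 2 + κ * s * Y ^ 2 / 2 + s ^ 2 * M ^ 2 := by
    rw [norm_add_smul_sq]
    have h1 : ‖U x‖ ^ 2 ≤ Y ^ 2 := pow_le_pow_left₀ (norm_nonneg _) (hle x) 2
    have h2 : 2 * σ * ⟪U x, V x⟫ ≤ κ * s * Y ^ 2 / 2 := by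
      -- `σ ∈ [−s, 0]` and `⟪U,V⟫ > −κY²/4`
      have hg' : -(κ * Y ^ 2 / 4) < ⟪U x, V x⟫ := hgx
      have hσ' : 0 ≤ -σ := by linarith
      have hσs : -σ ≤ s := by linarith
      have hpos : 0 ≤ κ * s * Y ^ 2 / 2 := by positivity
      rcases le_or_gt 0 ⟪U x, V x⟫ with hg0 | hg0
      · have : 0 ≤ -σ * ⟪U x, V x⟫ := mul_nonneg hσ' hg0
        linarith
      · have hng : 0 ≤ -⟪U x, V x⟫ := by linarith
        have hng' : -⟪U x, V x⟫ ≤ κ * Y ^ 2 / 4 := by linarith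
        have := mul_le_mul hσs hng' hng hs0.le
        nlinarith
    have h3 : σ ^ 2 * ‖V x‖ ^ 2 ≤ s ^ 2 * M ^ 2 := by
      have hσ2 : σ ^ 2 ≤ s ^ 2 := by
        rw [← sq_abs σ]; exact pow_le_pow_left₀ (abs_nonneg _) hσabs 2
      exact mul_le_mul hσ2 (pow_le_pow_left₀ (norm_nonneg _) hVx 2) (sq_nonneg _) (sq_nonneg _)
    linarith
  have hsM2 : s * (4 * (M ^ 2 + 1)) ≤ κ * Y ^ 2 := by
    have := hss.trans hs₀near
    rwa [le_div_iff₀ (by positivity)] at this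
  have hsq' : ((1 - κ * s) * ‖U x + σ • V x‖) ^ 2 < Y ^ 2 := by
    rw [mul_pow]
    have hf2 : (1 - κ * s) ^ 2 ≤ 1 - κ * s := by nlinarith
    have hsM : s * M ^ 2 < κ * Y ^ 2 / 2 := by nlinarith [sq_nonneg M]
    have key : s ^ 2 * M ^ 2 < κ * s * Y ^ 2 / 2 := by nlinarith
    have hA : 0 ≤ κ ^ 2 * s ^ 2 * Y ^ 2 / 2 := by positivity
    have hB : 0 ≤ κ * s ^ 3 * M ^ 2 := by positivity
    have expand : (1 - κ * s) * (Y ^ 2 + κ * s * Y ^ 2 / 2 + s ^ 2 * M ^ 2) =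
        Y ^ 2 - κ * s * Y ^ 2 / 2 + s ^ 2 * M ^ 2 - κ ^ 2 * s ^ 2 * Y ^ 2 / 2 - κ * s ^ 3 * M ^ 2 := by
      ring
    calc (1 - κ * s) ^ 2 * ‖U x + σ • V x‖ ^ 2
        ≤ (1 - κ * s) * (Y ^ 2 + κ * s * Y ^ 2 / 2 + s ^ 2 * M ^ 2) :=
          mul_le_mul hf2 hsq (sq_nonneg _) hfac0
      _ < Y ^ 2 := by rw [expand]; linarith
  exact lt_of_pow_lt_pow_left₀ 2 hY.le hsq'

/-- **THE GLOBAL ANCHOR OF THE PUSHED GERM**: under the weak test, with the width `s₀` of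
`exists_pushed_line_anchor` used both as the anchor scale and as the line width `σ₀ := s₀`, the pushed
germ has sup-norm `< Y` at every time `t < 1` (`0 < κ ≤ 1`). For `t ∈ [1 − s₀, 1)`:
`αpush t = 1 − κ(1 − t)` and `σline s₀ t ∈ [−(1 − t), 0]`; for `t < 1 − s₀`: `αpush t ≤ 1 − κ s₀` and
`σline s₀ t ∈ [−s₀, 0]`. [folklore] -/
theorem norm_germ_pushed_lt {Y κ s₀ : ℝ} (hκ0 : 0 < κ) (hκ1 : κ ≤ 1) (hs₀ : 0 < s₀) (hs₀h : s₀ ≤ 1 / 2)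
    (hanch : ∀ s : ℝ, 0 < s → s ≤ s₀ → ∀ σ : ℝ, -s ≤ σ → σ ≤ 0 →
      ∀ x, (1 - κ * s) * ‖U x + σ • accel ν U x‖ < Y)
    {t : ℝ} (ht : t < 1) (x : EuclideanSpace ℝ (Fin 3)) :
    ‖germ ν U (αpush κ) (βpush κ s₀) t x‖ < Y := by
  rw [germ_eq_smul_line_pushed, norm_smul, Real.norm_eq_abs,
    abs_of_nonneg (αpush_nonneg hκ0.le hκ1 ht.le)]
  have hσu : σline s₀ t ≤ 0 := σline_nonpos hs₀ ht.le
  by_cases hnear : 1 - s₀ ≤ t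
  · -- near the readout: exact factor `1 − κ(1 − t)`, `σ ∈ [−(1−t), 0]`
    have ht2 : 1 / 2 ≤ t := by linarith
    rw [αpush_of_half_le ht2]
    have hs : 0 < 1 - t := by linarith
    exact hanch (1 - t) hs (by linarith) (σline s₀ t) (sub_le_σline hs₀ t) hσu x
  · -- before: `αpush t ≤ 1 − κ s₀` and `σ ∈ [−s₀, 0]`
    rw [not_le] at hnear
    have hα : αpush κ t ≤ 1 - κ * s₀ := by
      rcases le_or_gt t 0 with h0 | h0
      · rw [αpush_of_nonpos h0]; nlinarith
      · exact (αpush_le_factor hκ0.le hκ1 h0.le ht.le).trans (by nlinarith)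
    have hσl : -s₀ ≤ σline s₀ t := (neg_lt_σline hs₀ t).le
    have h := hanch s₀ hs₀ le_rfl (σline s₀ t) hσl hσu x
    calc αpush κ t * ‖U x + σline s₀ t • accel ν U x‖
        ≤ (1 - κ * s₀) * ‖U x + σline s₀ t • accel ν U x‖ :=
          mul_le_mul_of_nonneg_right hα (norm_nonneg _)
      _ < Y := h

/-- … and `≤ Y` up to and including `t = 1`. [folklore] -/
theorem norm_germ_pushed_le {Y κ s₀ : ℝ} (hκ0 : 0 < κ) (hκ1 : κ ≤ 1) (hs₀ : 0 < s₀) (hs₀h : s₀ ≤ 1 / 2)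
    (hle : ∀ x, ‖U x‖ ≤ Y)
    (hanch : ∀ s : ℝ, 0 < s → s ≤ s₀ → ∀ σ : ℝ, -s ≤ σ → σ ≤ 0 →
      ∀ x, (1 - κ * s) * ‖U x + σ • accel ν U x‖ < Y)
    {t : ℝ} (ht : t ≤ 1) (x : EuclideanSpace ℝ (Fin 3)) :
    ‖germ ν U (αpush κ) (βpush κ s₀) t x‖ ≤ Y := by
  rcases ht.lt_or_eq with h | h
  · exact (norm_germ_pushed_lt hκ0 hκ1 hs₀ hs₀h hanch h x).le
  · rw [h, germ_pushed_one]; exact hle x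

end Anchor

end Summit.NavierStokesRegularity.FluidComputer.PalasekTowerClayBridge.Germ

end
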